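import Summits.HubbardSuperconductivity.HubbardSuperconductivity.Theses.BalabanIR
import Literature.Probability.LatticeModels.BalabanStepOneFormat
import Summits.HubbardSuperconductivity.HubbardSuperconductivity.Theorems.BalabanIRBirGappedPhaseReductionRFormatSplit
import HarnessLib

/-!
# Strategist s3 sketch — crux `BalabanIR.BirGroundStateAverageLRO` (stmt-HubbardSuperconductivity-2079)

Companion of `STRATEGY-CENSUS.md` (gen 1, re-arm s3, 2026-08-17) and of the alternative line `Lines/format_pair.lean`.
Kernel-checked facts about the FORMAT PAIR `{C1 = BirFormatEngine, C2 = BirFormatMembershipTransfer}` (4R strategist s1,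
`Cruxes/BirGappedPhaseReductionR/SPLIT-PROPOSAL.md`) read as a decomposition of THIS crux:

* `crux_of_formatPair : C1 → C2 → BirGroundStateAverageLRO` — the landed glue
  `Theorems.birGappedPhaseReductionR_of_formatPair_target` (p160973) concludes X_avg's body, so the pair is a split of X_avg
  (the natural parent: `fourR_of_crux : BirGroundStateAverageLRO → BirGappedPhaseReductionR` is one line).
* `c2_of_not_formatEngine : ¬ C1 → C2` — RECORDED SMELL (new): a format member violating the engine conclusion at every
  threshold level makes C2's inner implication vacuous, so C2 is closed by any constructive refutation of C1.  Consequence: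
  the children are JOINTLY load-bearing (`C1 ∧ C2` is the content; `C2` alone is `C1 → (membership ∧ transfer)` in
  disguise); harmless for the split (`crux_of_formatPair` consumes both), but a refuter/tribunal reading C2 severally must
  know it, and a prover "closing" C2 through `¬C1` has killed the engine, not advanced the crux.
* `formatPair_content_iff : (C1 ∧ C2) ↔ (C1 ∧ C2)` is NOT stated — the honest reformulation of C2 that removes the smell needs a
  NAMED Hubbard-side weight (the cyclic Trotter weight of the slaved block pair field), i.e. a Defs item; recorded in the census
  (§Decomposition D6) as the one typing improvement left to tenure.
-/

set_option linter.dupNamespace false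

noncomputable section

namespace Summit.HubbardSuperconductivity.HubbardSuperconductivity.Cruxes.BirGroundStateAverageLRO.StrategistS3

open scoped BigOperators ComplexConjugate
open MeasureTheory Filter Literature.Probability.LatticeModels Literature.MathematicalPhysics.QuantumLattice
open Summit.HubbardSuperconductivity.HubbardSuperconductivity.Theses.BalabanIR
open Summit.HubbardSuperconductivity.HubbardSuperconductivity.Theorems

/-- C1 = `BirFormatEngine` (verbatim body; 4R strategist s1 children.json / line format-pair). -/
def C1 : Prop :=
  ∀ (B c₀ cL : ℝ), 0 < c₀ → 0 < cL → ∃ κ₀ K₀ : ℝ, ∃ L₀ : ℕ, ∀ (κ K : ℝ), κ₀ ≤ κ → K₀ ≤ K → ∀ (L' M : ℕ) [NeZero L'] [NeZero M], L₀ ≤ L' → L' ≤ M → Even L' → Even M → ∀ ρ : (Literature.Probability.LatticeModels.TorusSite 2 L' × ZMod M → ℝ) → ℂ, Literature.Probability.LatticeModels.BalabanStepOne.StepOneFormat K B c₀ cL κ L' M ρ → Literature.Probability.LatticeModels.BalabanStepOne.EngineConclusion L' M ρ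

/-- C2 = `BirFormatMembershipTransfer` (verbatim body). -/
def C2 : Prop :=
  ∃ δ ∈ Set.Ioo (0:ℝ) (1/2), ∃ (B c₀ cL : ℝ), 0 < c₀ ∧ 0 < cL ∧ ∀ (κ₀ K₀ : ℝ) (L₀ : ℕ), ∃ U₁ U₂ cP : ℝ, 0 < U₁ ∧ U₁ < U₂ ∧ 0 < cP ∧ ∀ U ∈ Set.Ioo U₁ U₂, ∃ L₁ : ℕ, ∀ (L : ℕ) [NeZero L], L₁ ≤ L → Even L → let N : ℕ := 2 * ⌊(1 - δ) * (L : ℝ) ^ 2 / 2⌋₊; let H := Literature.MathematicalPhysics.QuantumLattice.hubbardTorus 2 L 1 U; let S := Literature.MathematicalPhysics.QuantumLattice.szSector (Λ := Literature.MathematicalPhysics.QuantumLattice.FermionTorus 2 L) N 0; let PS := Literature.MathematicalPhysics.QuantumLattice.projMatrix (S.map (Literature.MathematicalPhysics.QuantumLattice.Fock.toEuclidean (ι := Literature.MathematicalPhysics.QuantumLattice.Orb (Literature.MathematicalPhysics.QuantumLattice.FermionTorus 2 L)) : Literature.MathematicalPhysics.QuantumLattice.Fock (Literature.MathematicalPhysics.QuantumLattice.Orb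 (Literature.MathematicalPhysics.QuantumLattice.FermionTorus 2 L)) →ₗ[ℂ] EuclideanSpace ℂ (Finset (Literature.MathematicalPhysics.QuantumLattice.Orb (Literature.MathematicalPhysics.QuantumLattice.FermionTorus 2 L))))); ∃ᶠ β : ℝ in Filter.atTop, ∃ (κ K : ℝ), κ₀ ≤ κ ∧ K₀ ≤ K ∧ ∃ (L' M : ℕ) (_ : NeZero L') (_ : NeZero M), L₀ ≤ L' ∧ L' ≤ M ∧ Even L' ∧ Even M ∧ ∃ ρ : (Literature.Probability.LatticeModels.TorusSite 2 L' × ZMod M → ℝ) → ℂ, Literature.Probability.LatticeModels.BalabanStepOne.StepOneFormat K B c₀ cL κ L' M ρ ∧ (Literature.Probability.LatticeModels.BalabanStepOne.EngineConclusion L' M ρ → cP * (L : ℝ) ^ 4 ≤ ((PS * Matrix.gibbsWeight β H * (Matrix.conjTranspose (Literature.MathematicalPhysics.QuantumLattice.pairField Literature.MathematicalPhysics.QuantumLattice.dWaveFormFactor L) * Literature.MathematicalPhysics.QuantumLattice.pairField Literature.MathematicalPhysics.QuantumLattice.dWaveFormFactor L)).trace / (PS * Matrix.gibbsWeight β H)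.trace).re)

/-- **The format pair is a split of X_avg** (landed glue p160973, conclusion = the crux by name after `unfold`). -/
theorem crux_of_formatPair (h1 : C1) (h2 : C2) : BirGroundStateAverageLRO := by
  unfold BirGroundStateAverageLRO
  exact birGappedPhaseReductionR_of_formatPair_target h1 h2

/-- X_avg is the natural parent: 4R is X_avg weakened by two (inert) hypotheses. -/
theorem fourR_of_crux (h : BirGroundStateAverageLRO) : BirGappedPhaseReductionR := fun _ _ => h

/-- **Recorded smell: `¬C1 → C2`.** If the engine fails for some class data `(B, c₀, cL)` at EVERY threshold level — i.e. for
all `(κ₀, K₀, L₀)` some format member at `κ ≥ κ₀`, `K ≥ K₀` on some even block torus `L₀ ≤ L' ≤ M` violates the engine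
conclusion — then C2 holds with that member as witness and its inner implication vacuous (any `δ`, any window, any `cP`).
So C2 is severally closable by a constructive refutation of C1; the pair `C1 ∧ C2` is what carries content. -/
theorem c2_of_not_formatEngine (h : ¬ C1) : C2 := by
  unfold C1 at h
  push Not at h
  obtain ⟨B, c₀, cL, hc₀, hcL, hbad⟩ := h
  refine ⟨1/4, by norm_num, B, c₀, cL, hc₀, hcL, fun κ₀ K₀ L₀ => ?_⟩
  obtain ⟨κ, K, hκ, hK, L', M, _, _, hL₀, hLM, hL'e, hMe, ρ, hρ, hnot⟩ := hbad κ₀ K₀ L₀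
  refine ⟨1, 2, 1, by norm_num, by norm_num, by norm_num, fun U _ => ⟨0, fun L _ _ _ => ?_⟩⟩
  dsimp only
  refine Filter.Frequently.of_forall fun β => ?_
  exact ⟨κ, K, hκ, hK, L', M, ‹NeZero L'›, ‹NeZero M›, hL₀, hLM, hL'e, hMe, ρ, hρ, fun hc => absurd hc hnot⟩

end Summit.HubbardSuperconductivity.HubbardSuperconductivity.Cruxes.BirGroundStateAverageLRO.StrategistS3

end
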